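import Summits.AtomisticToContinuum.HydrodynamicLimit.Theses.InformationPercolationEngine
import Summits.AtomisticToContinuum.HydrodynamicLimit.Statement
import HarnessLib.Audit.CruxProbe

/-! BC7 battery (incl. P5 `C → S` / `S → C`) on the crux `LocalSecondLaw` (stmt-13081), redirect strategist r1. -/

#h21_crux_probe Summit.AtomisticToContinuum.HydrodynamicLimit.Theses.InformationPercolationEngine.LocalSecondLaw summit := HydrodynamicLimit route := "route-AtomisticToContinuum-InformationPercolationEngine"
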